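import Mathlib
import Literature.NumberTheory.LFunctions.Zhang2022.SkeletonPartOne
import Literature.NumberTheory.LFunctions.Zhang2022.Section3PhiStar
import Literature.NumberTheory.LFunctions.Zhang2022.Section5Lemma57
import Literature.NumberTheory.LFunctions.DivisorSumCharSqLSeries
import Literature.NumberTheory.LFunctions.DivisorSumCharSqSmoothedMoment
import HarnessLib

/-!
# Zhang (2022), §3 «The set Ψ₁» TYPED: every displayed claim of §3 (tex L702–L863, PDF pp. 12–16)
# as a named `Prop` over the banked skeleton objects — campaign D-0069, layer L1, file `TypedSection03`

Topic `Literature/NumberTheory/LFunctions/Zhang2022` (Landau–Siegel audit tree; verdict-neutral).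
Y. Zhang, *Discrete mean estimates and the Landau–Siegel zero*, arXiv:2211.02515v1 (2022)
[Zhang2022LandauSiegel] — **an unrefereed manuscript under adjudication. Every `def … : Prop` below
is a CLAIM OF THE MANUSCRIPT, STATED NOT ASSERTED; nothing here asserts or denies its Theorems 1–2.**
A `theorem` below is either a definitional bridge to a banked skeleton node or a claim that the
tree already proves (then the node is born discharged). No named fact is introduced.

The section's NUMBERED statements are already banked skeleton nodes and are CITED, not restated:
Lemma 3.1 = `Skeleton.Lemma31` (display (3.2); DISCHARGED `Skeleton.lemma31_holds`), Lemma 3.2 =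
`Skeleton.Lemma32`, Lemma 3.3 = `Skeleton.Lemma33a ∧ Skeleton.Lemma33b`, Lemmas 3.4–3.6 =
`Skeleton.Lemma34/35/36` with (3.4)–(3.6) = `Skeleton.Ineq34/35/36`, the objects `ν, υ, ν₂₀, υ₂₀, ς,
X₁…X₄, F, G, Ψ₁` = `Skeleton.nu/ups/nu20/ups20/sig/X1…X4/Fpoly/Gpoly/PsiOne`, and "Proposition 2.1
follows from Lemma 3.4, 3.5 and 3.6 immediately" (p. 16) = the kernel edge `Skeleton.prop21_of_lemmas`.
This file types the REMAINING displays of §3 — the proof-internal claims — one declaration per node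
of the campaign DAG (`plan/DAG.tsv`, ids `Z22:§3.uNNN` / `Z22:(3.k)`), names from the node ids:

| node | p. | decl | kind |
|---|---|---|---|
| `§3.u001` | 12 | `Step3u001` (+ `step3u001_nu` PROVED) | generating series of `ν`, `υ` |
| `(3.1)` | 12 | `Eq31` (+ `eq31_right` PROVED) | `|υ(n)| ≤ ν(n) ≤ τ₂(n)` |
| `§3.u002` | 12 | `phiSeries` (+ `phiSeries_eq_phi` PROVED) | `φ(s) = ζ⁻²L⁻²Σν²n⁻ˢ` |
| `§3.u003` | 13 | `phiLocal`, `Step3u003` | Euler product `φ = ∏ φ_p` |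
| `§3.u004`, `§3.u005` | 13 | `Step3u004`, `Step3u005` | `φ_p = 1 + O(p^{−2σ})` (`p ∤ D`), `= (1 − p⁻ˢ)(1 + O(p^{−2σ}))` (`p ∣ D`) |
| prose L729 | 13 | `phi_differentiableOn` PROVED | "φ is analytic for σ > 1/2" |
| `(3.3)` | 13 | `Eq33` | `φ(s) ≪ ∏_{p∣D}|1 − p⁻ˢ|`, `σ ≥ σ₁ > 1/2` |
| `§3.u006` | 13 | `Step3u006a`, `Step3u006b` | smoothing inequality; Mellin identity |
| `§3.u007` | 13 | `alphaStar`, `Step3u007` | residue at `0` = circle integral `|s| = α* = 𝓛⁻²⁰²⁴` up to `O(D^{−c})` |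
| `§3.u008` | 13 | `Step3u008` (+ `step3u008_holds` PROVED) | `L(1+s,χ) ≪ 𝓛⁻²⁰²²` on `|s| = α*` |
| `§3.u009` | 13 | `Step3u009` | `ζ(1+s) ≪ 𝓛²⁰²⁴`, `(P^{2s} − D^{4s})Γ(s) ≪ 𝓛⁹` on `|s| = α*` |
| `Lem3.1.pf` | 12 | `Ded31` (+ `ded31_holds` PROVED) | the deduction, discharged with its conclusion |
| `§3.u010` | 13 | — | = `Skeleton.Lemma32` (cited) |
| `§3.u011` | 13 | `phiStarSeries` (+ `phiStarSeries_eq_phiStar` PROVED) | `φ*(s) = ζ⁻⁸L⁻⁸Σν²τ₂²n⁻ˢ` |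
| prose L768 | 14 | `phiStar_differentiableOn` PROVED | "φ* is analytic for σ > 1/2" |
| `§3.u012`, `§3.u013` | 14 | `Step3u012`, `Step3u013` | `φ* ≪ ∏_{p∣D}|1 − p^{−4s}|`; the circle integral `≪ 𝓛⁻²⁰⁰⁷` |
| `Lem3.2.pf` | 13 | `Ded32` | deduction node |
| `§3.u014`, `§3.u015`, `Lem3.3.pf` | 14 | — | = `Skeleton.Lemma33a`, `Skeleton.Lemma33b` (cited; proofs = tree `weighted_orthogonality_meanValue`, `weighted_largeSieve_meanValue`) |
| `§3.u016`, `§3.u018`, `§3.u020`, `§3.u022`, `§3.u023` | 14–15 | — | = `Skeleton.Fpoly/Gpoly`, `X1/X2`, `X3`, `sig`, `X4` (cited) |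
| `§3.u017` | 15 | `tauK`, `Step3u017` | `F²⁰ = Σ_{n≤D⁸⁰}ν₂₀ψn⁻ˢ`, `|ν₂₀|, |υ₂₀| ≤ τ₄₀` |
| `§3.u019` | 15 | `lhs34` (+ `ineq34_iff` PROVED), `Step3u019` | second moment `≪ 𝔓𝓛¹⁶⁰²` |
| `Lem3.4` ("Thus we conclude") | 15 | `Ded34` | deduction node `Step3u019 → Skeleton.Lemma34` |
| `§3.u021` | 15 | `lhs35` (+ `ineq35_iff`), `Step3u021a`, `Step3u021b` | second moment `≪ P²𝓛⁻¹⁹⁹³ ≪ 𝔓𝓛⁻¹⁹⁰⁹` |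
| `Lem3.5` ("Thus we conclude") | 15 | `Ded35` | `Step3u021a → Step3u021b → Skeleton.Lemma35` |
| prose L846 | 15 | `SigSupport` | "ς(n) = 0 unless n = 1 or D⁴ < n ≤ D⁸" |
| `§3.u024` | 16 | `Step3u024` | `|ς(n)| ≤ Σ_{n=lm}ν(l)|υ(m)| ≤ ν(n)τ₂(n)` |
| `§3.u025` | 16 | `lhs36` (+ `ineq36_iff`), `Step3u025` | second moment `≪ 𝔓𝓛⁻²⁰⁰⁵` |
| `Lem3.6` ("Thus we conclude") | 16 | `Ded36` | `Step3u025 → Skeleton.Lemma36` |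

Conventions (campaign `plan/L1/ASSIGNMENTS.md` §3): "X ≪ Y" ↦ `∃ C, … ≤ C * Y`; claims about `D`
large under `Skeleton.ForAllLarge`; **Assumption (A)** (`Skeleton.AssumptionA D χ`) is an antecedent
exactly where print has it — Lemmas 3.1, 3.2, 3.5, 3.6 and the proof steps under those headings
("Assume (A) holds", tex L711, L757, L828, L854); (3.1), Lemma 3.3, (3.4)/Lemma 3.4 and the
definitions are unconditional in print and typed so. The analytic continuation of `φ` to `σ > 1/2`
that (3.3) and the contour shift speak about is the tree's closed form `DivisorSumCharSq.phi D`
(`= (ζ(2s)∏_{p∣D}(1 + p⁻ˢ))⁻¹`; `phiSeries_eq_phi` identifies it with the printed `ζ⁻²L⁻²Σν²n⁻ˢ` on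
`σ > 1`), and likewise `φ*` is the tree's `PhiStar.phiStar χ` (`phiStarSeries_eq_phiStar`).
Print slips quoted, not fixed: "the second assertion of Lemma 3.2" (tex L828) and "the first
assertion of Lemma 3.2" (L854) mean Lemma 3.3; "|\nu_{20}{n}|" (L804) means `|ν₂₀(n)|`.

## References

* Y. Zhang, arXiv:2211.02515v1 (2022), §3 pp. 12–16, tex L697–L874.
  [cite: Zhang2022LandauSiegel, §3 pp. 12–16]
-/

noncomputable section

open Complex Real MeasureTheory
open scoped LSeries.notation

namespace Literature.NumberTheory.LFunctions.Zhang2022.Section3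

open Literature.NumberTheory.LFunctions (divisorSumChar norm_divisorSumChar_le)

/-! ## §3 p. 12: `ν`, `υ` and (3.1) -/

section Coefficients

variable {D : ℕ} [NeZero D] (χ : DirichletCharacter ℂ D)

/-- `Z22:§3.u001` [Z22 p.12, tex L702] «Let ν(n) and υ(n) be given by
`ζ(s)L(s,χ) = Σ_n ν(n)n⁻ˢ`, `ζ(s)⁻¹L(s,χ)⁻¹ = Σ_n υ(n)n⁻ˢ`, σ > 1, respectively.» The manuscript's
DEFINITION of `ν`, `υ` by generating series; the skeleton defines them arithmetically
(`Skeleton.nu = 1 ∗ χ = divisorSumChar χ`, `Skeleton.ups = μ ∗ μχ`), so the two series identities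
are the claim typed here (the `ν`-half is PROVED, `step3u001_nu`). Unconditional.
[cite: Zhang2022LandauSiegel, §3 p.12] -/
def Step3u001 : Prop :=
  ∀ s : ℂ, 1 < s.re →
    L (Skeleton.nu χ) s = riemannZeta s * χ.LFunction s ∧
    L (Skeleton.ups χ) s = (riemannZeta s)⁻¹ * (χ.LFunction s)⁻¹

/-- The `ν`-half of `Z22:§3.u001` is a theorem of the tree: `Σ ν(n)n⁻ˢ = ζ(s)L(s,χ)` for `σ > 1`
(`Lemma57.LSeries_divisorSumChar`; `Skeleton.nu χ` is `divisorSumChar χ` by definition).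
[cite: Zhang2022LandauSiegel, §3 p.12] -/
theorem step3u001_nu {s : ℂ} (hs : 1 < s.re) :
    L (Skeleton.nu χ) s = riemannZeta s * χ.LFunction s :=
  Lemma57.LSeries_divisorSumChar χ hs

/-- `Z22:(3.1)` [Z22 p.12, (3.1), tex L706] «It is easy to see that `|υ(n)| ≤ ν(n) ≤ τ₂(n)`.» For the
real character `χ`, `ν(n)` is real (typed through `Re ν(n)` with `Im ν(n) = 0`); `τ₂(n)` = the number
of divisors of `n`. Unconditional. (Tree: the real-arithmetic-function versions
`Zhang2022.abs_upsilonOf_le_nuOf`, `nuOf_le_card_divisors`; the right half is PROVED below.)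
[cite: Zhang2022LandauSiegel, §3 (3.1) p.12] -/
def Eq31 : Prop :=
  ∀ n : ℕ, (Skeleton.nu χ n).im = 0 ∧ ‖Skeleton.ups χ n‖ ≤ (Skeleton.nu χ n).re ∧
    (Skeleton.nu χ n).re ≤ (n.divisors.card : ℝ)

omit [NeZero D] in
/-- The right half of (3.1), `ν(n) ≤ τ₂(n)`, is a theorem of the tree
(`norm_divisorSumChar_le`: `|Σ_{d∣n}χ(d)| ≤ #divisors`). [cite: Zhang2022LandauSiegel, §3 (3.1) p.12] -/
theorem eq31_right (n : ℕ) : (Skeleton.nu χ n).re ≤ (n.divisors.card : ℝ) :=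
  (Complex.re_le_norm _).trans (norm_divisorSumChar_le χ n)

end Coefficients

/-! ## §3 pp. 12–13: the proof of Lemma 3.1 — `φ`, its Euler factors, (3.3), the contour shift -/

section LemmaThreeOne

variable {D : ℕ} [NeZero D] (χ : DirichletCharacter ℂ D)

/-- `Z22:§3.u002` [Z22 p.12, tex L718] «Let `φ(s) = ζ(s)⁻²L(s,χ)⁻²Σ_n ν(n)²n⁻ˢ`» — the printed
definition (meaningful for `σ > 1`, where the series converges); its continuation to `σ > 1/2` is the
tree's closed form `DivisorSumCharSq.phi D` (`phiSeries_eq_phi`). [cite: Zhang2022LandauSiegel, §3 p.12] -/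
def phiSeries (s : ℂ) : ℂ :=
  (riemannZeta s ^ 2)⁻¹ * (χ.LFunction s ^ 2)⁻¹ * L (fun n => Skeleton.nu χ n ^ 2) s

/-- **`φ` in closed form**: for the real character `χ` (`χ² = 1`) and `σ > 1`,
`φ(s) = (ζ(2s)∏_{p∣D}(1 + p⁻ˢ))⁻¹ = DivisorSumCharSq.phi D s` (tree
`DivisorSumCharSq.LSeries_divisorSumChar_sq_eq_div_LFunction`). [cite: Zhang2022LandauSiegel, §3 p.12–13] -/
theorem phiSeries_eq_phi (hχ : χ ^ 2 = 1) {s : ℂ} (hs : 1 < s.re) :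
    phiSeries χ s = DivisorSumCharSq.phi D s := by
  have hζ : riemannZeta s ≠ 0 := riemannZeta_ne_zero_of_one_lt_re hs
  have hs1 : s ≠ 1 := fun h => by simp [h] at hs
  have hL : χ.LFunction s ≠ 0 :=
    DirichletCharacter.LFunction_ne_zero_of_one_le_re χ (Or.inr hs1) hs.le
  have hden : riemannZeta (2 * s) * ∏ p ∈ D.primeFactors, (1 + (p : ℂ) ^ (-s)) ≠ 0 :=
    DivisorSumCharSq.zeta_two_mul_mul_prod_ne_zero hs
  have key := DivisorSumCharSq.LSeries_divisorSumChar_sq_eq_div_LFunction χ hχ hs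
  unfold phiSeries Skeleton.nu
  rw [key, DivisorSumCharSq.phi_def]
  field_simp

/-- The local Euler factor `φ_p(s)` of `φ` (implicit in `Z22:§3.u003`: the `p`-factor of
`ζ(s)⁻²L(s,χ)⁻²Σν(n)²n⁻ˢ`), i.e. `(1 − p⁻ˢ)²(1 − χ(p)p⁻ˢ)²·Σ_{e≥0} ν(pᵉ)²p^{−es}`.
[cite: Zhang2022LandauSiegel, §3 p.13] -/
def phiLocal (p : ℕ) (s : ℂ) : ℂ :=
  (1 - (p : ℂ) ^ (-s)) ^ 2 * (1 - χ (p : ZMod D) * (p : ℂ) ^ (-s)) ^ 2 *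
    ∑' e : ℕ, Skeleton.nu χ (p ^ e) ^ 2 * (p : ℂ) ^ (-((e : ℂ) * s))

/-- `Z22:§3.u003` [Z22 p.13, tex L722] «which has the Euler product representation
`φ(s) = ∏_p φ_p(s)` (σ > 1).» CLAIM. [cite: Zhang2022LandauSiegel, §3 p.13] -/
def Step3u003 : Prop :=
  ∀ s : ℂ, 1 < s.re → HasProd (fun p : Nat.Primes => phiLocal χ (p : ℕ) s) (phiSeries χ s)

/-- `Z22:§3.u004` [Z22 p.13, tex L726] «For `σ ≥ σ₀ > 0`, by checking the cases `χ(p) = ±1` and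
`χ(p) = 0` respectively, … `φ_p(s) = 1 + O(p^{−2σ})` if `p ∤ D` … the implied constant depending on
`σ₀`.» CLAIM. [cite: Zhang2022LandauSiegel, §3 p.13] -/
def Step3u004 : Prop :=
  ∀ σ₀ : ℝ, 0 < σ₀ → ∃ C : ℝ, ∀ (D : ℕ) [NeZero D] (χ : DirichletCharacter ℂ D), χ.IsQuadratic →
    ∀ p : ℕ, p.Prime → ¬ p ∣ D → ∀ s : ℂ, σ₀ ≤ s.re →
      ‖phiLocal χ p s - 1‖ ≤ C * (p : ℝ) ^ (-2 * s.re)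

/-- `Z22:§3.u005` [Z22 p.13, tex L728] «and `φ_p(s) = (1 − p⁻ˢ)(1 + O(p^{−2σ}))` if `p ∣ D`, the
implied constant depending on `σ₀`» (`σ ≥ σ₀ > 0`). CLAIM. [cite: Zhang2022LandauSiegel, §3 p.13] -/
def Step3u005 : Prop :=
  ∀ σ₀ : ℝ, 0 < σ₀ → ∃ C : ℝ, ∀ (D : ℕ) [NeZero D] (χ : DirichletCharacter ℂ D), χ.IsQuadratic →
    ∀ p : ℕ, p.Prime → p ∣ D → ∀ s : ℂ, σ₀ ≤ s.re →
      ‖phiLocal χ p s - (1 - (p : ℂ) ^ (-s))‖ ≤ C * ‖1 - (p : ℂ) ^ (-s)‖ * (p : ℝ) ^ (-2 * s.re)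

omit [NeZero D] in
/-- [Z22 p.13, tex L729] «Thus `φ(s)` is analytic for `σ > 1/2`» — PROVED for the continuation
`DivisorSumCharSq.phi D` (tree `DivisorSumCharSq.differentiableAt_phi`).
[cite: Zhang2022LandauSiegel, §3 p.13] -/
theorem phi_differentiableOn (D : ℕ) :
    DifferentiableOn ℂ (DivisorSumCharSq.phi D) {s : ℂ | 1 / 2 < s.re} :=
  fun _ hs => (DivisorSumCharSq.differentiableAt_phi D hs).differentiableWithinAt

/-- `Z22:(3.3)` [Z22 p.13, (3.3), tex L730] «and it satisfies `φ(s) ≪ ∏_{p∣D}|1 − p⁻ˢ|` for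
`σ ≥ σ₁ > 1/2`, the implied constant depending on `σ₁`» (on the continuation `DivisorSumCharSq.phi D`;
uniform in `D` and the real primitive `χ`). CLAIM. [cite: Zhang2022LandauSiegel, §3 (3.3) p.13] -/
def Eq33 : Prop :=
  ∀ σ₁ : ℝ, 1 / 2 < σ₁ → ∃ C : ℝ, ∀ (D : ℕ) (s : ℂ), σ₁ ≤ s.re →
    ‖DivisorSumCharSq.phi D s‖ ≤ C * ∏ p ∈ D.primeFactors, ‖1 - (p : ℂ) ^ (-s)‖

/-- `Z22:§3.u006`, first line [Z22 p.13, tex L734] «The left side of (3.2) is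
`≪ Σ_n ν(n)²n⁻¹(exp{−n/P²} − exp{−n/D⁴})`» (under the heading "Assume (A) holds" of Lemma 3.1;
the smoothing weights are `≥ 0`, and `≫ 1` on `D⁴ < n ≤ P²`; tree `Lemma31.sum_Ioc_le`,
`Lemma31.one_sixth_le_exp_sub_exp`). CLAIM. [cite: Zhang2022LandauSiegel, §3 p.13] -/
def Step3u006a : Prop :=
  ∃ C : ℝ, Skeleton.ForAllLarge fun D _ χ => Skeleton.AssumptionA D χ →
    ‖∑ n ∈ Finset.Ioc (D ^ 4) ⌊Skeleton.bigP D ^ 2⌋₊, Skeleton.nu χ n ^ 2 / (n : ℂ)‖ ≤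
      C * ∑' n : ℕ, ‖Skeleton.nu χ n‖ ^ 2 / n *
        (Real.exp (-(n / Skeleton.bigP D ^ 2)) - Real.exp (-(n / (D : ℝ) ^ 4)))

/-- The integrand of the contour integrals of `Z22:§3.u006`/`u007`:
`φ(1+s)ζ(1+s)²L(1+s,χ)²(P^{2s} − D^{4s})Γ(s)` (`φ` = the continuation `DivisorSumCharSq.phi D`).
[cite: Zhang2022LandauSiegel, §3 p.13] -/
def integrand31 (s : ℂ) : ℂ :=
  DivisorSumCharSq.phi D (1 + s) * riemannZeta (1 + s) ^ 2 * χ.LFunction (1 + s) ^ 2 *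
    (((Skeleton.bigP D : ℝ) : ℂ) ^ (2 * s) - ((D : ℝ) : ℂ) ^ (4 * s)) * Complex.Gamma s

/-- `Z22:§3.u006`, second line [Z22 p.13, tex L737] «`= (1/2πi)∫_{(1)} φ(1+s)ζ(1+s)²L(1+s,χ)²
(P^{2s} − D^{4s})Γ(s) ds`» — the Mellin identity for the smoothed second moment (line `Re s = 1`,
`ds = i dy`; cf. tree `DivisorSumCharSq.integral_Gamma_cpow_LSeries_eq`). CLAIM.
[cite: Zhang2022LandauSiegel, §3 p.13] -/
def Step3u006b : Prop :=
  Skeleton.ForAllLarge fun D _ χ => Skeleton.AssumptionA D χ →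
    ((∑' n : ℕ, ‖Skeleton.nu χ n‖ ^ 2 / n *
        (Real.exp (-(n / Skeleton.bigP D ^ 2)) - Real.exp (-(n / (D : ℝ) ^ 4))) : ℝ) : ℂ) =
      (1 / (2 * π)) * ∫ y : ℝ, integrand31 χ (1 + y * I)

omit [NeZero D] in
/-- `α* = 𝓛⁻²⁰²⁴`, the radius of the residue circle of `Z22:§3.u007` [Z22 p.13, tex L744].
[cite: Zhang2022LandauSiegel, §3 p.13] -/
def alphaStar (D : ℕ) : ℝ := (Skeleton.ell D ^ 2024)⁻¹

/-- `Z22:§3.u007` [Z22 p.13, tex L740–744] «Moving the line of integration to the left appropriately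
and applying standard estimates, we see that the right side is equal to the residue of the integrand
plus an acceptable error `O(D^{−c})`. The residue at `s = 0` can be written as
`(1/2πi)∫_{|s|=α*} φ(1+s)ζ(1+s)²L(1+s,χ)²(P^{2s} − D^{4s})Γ(s) ds` with `α* = 𝓛⁻²⁰²⁴`.» CLAIM
(line integral = circle integral + `O(D^{−c})`; v2: the line integral is parenthesised — in v1 the
`∫ y` binder swallowed the `− (1/2πi)∮ …` term, L2-t9 integral-binder scan).
[cite: Zhang2022LandauSiegel, §3 p.13] -/
def Step3u007 : Prop :=
  ∃ c : ℝ, 0 < c ∧ ∃ C : ℝ, Skeleton.ForAllLarge fun D _ χ => Skeleton.AssumptionA D χ →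
    ‖(1 / (2 * π)) * (∫ y : ℝ, integrand31 χ (1 + y * I)) -
        (1 / (2 * π * I)) * (∮ z in C(0, alphaStar D), integrand31 χ z)‖ ≤ C * (D : ℝ) ^ (-c)

/-- `Z22:§3.u008` [Z22 p.13, tex L746] «If `|s| = α*`, then … `L(1+s,χ) ≪ 𝓛⁻²⁰²²` by (A) and
standard estimates.» CLAIM — and PROVED (`step3u008_holds`). [cite: Zhang2022LandauSiegel, §3 p.13] -/
def Step3u008 : Prop :=
  ∃ C : ℝ, Skeleton.ForAllLarge fun D _ χ => Skeleton.AssumptionA D χ →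
    ∀ s : ℂ, ‖s‖ = alphaStar D → ‖χ.LFunction (1 + s)‖ ≤ C * (Skeleton.ell D ^ 2022)⁻¹

omit [NeZero D] in
/-- `log D ≥ 3` once `D ≥ ⌈e³⌉`. [folklore] -/
private theorem three_le_log {D : ℕ} (hD : ⌈Real.exp 3⌉₊ ≤ D) : 3 ≤ Real.log D := by
  have h : Real.exp 3 ≤ D := le_trans (Nat.le_ceil _) (by exact_mod_cast hD)
  exact (Real.le_log_iff_exp_le (lt_of_lt_of_le (Real.exp_pos _) h)).mpr h

/-- **`Z22:§3.u008` holds**: with `C = 1 + 4e^{9/2}`, for `log D ≥ 3`: (A) gives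
`‖L(1,χ)‖ < 𝓛⁻²⁰²²`, and the "standard estimate" is the tree's mean-value bound
`‖L(1+s,χ) − L(1,χ)‖ ≤ 2e^{9/2}(1+𝓛)𝓛·|s|` (`Lemma31.norm_LFunction_one_add_sub_le`), `|s| = 𝓛⁻²⁰²⁴`.
[cite: Zhang2022LandauSiegel, §3 p.13] -/
theorem step3u008_holds : Step3u008 := by
  refine ⟨1 + 4 * Real.exp (9 / 2), ⌈Real.exp 3⌉₊, fun D _ χ hD _ hp hA s hs => ?_⟩
  have hlog : 3 ≤ Real.log D := three_le_log hD
  have hℓ : Skeleton.ell D = Real.log D := rfl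
  rw [alphaStar, hℓ] at hs
  rw [hℓ]
  set ℓ : ℝ := Real.log D with hℓdef
  have hℓ0 : 0 < ℓ := by linarith
  have hℓ1 : 1 ≤ ℓ := by linarith
  have hs' : ‖s‖ ≤ 1 / ℓ := by
    rw [hs, one_div]
    exact inv_anti₀ hℓ0 (le_self_pow₀ hℓ1 (by norm_num))
  have hmv := Lemma31.norm_LFunction_one_add_sub_le χ hlog hp hs'
  have hA' : ‖χ.LFunction 1‖ < (ℓ ^ 2022)⁻¹ := by
    have := hA; rw [Skeleton.AssumptionA] at this; rwa [← one_div]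
  have h1 : 2 * Real.exp (9 / 2) * (1 + ℓ) * ℓ * ‖s‖ ≤ 4 * Real.exp (9 / 2) * (ℓ ^ 2022)⁻¹ := by
    rw [hs]
    have h2 : (1 + ℓ) * ℓ ≤ 2 * ℓ ^ 2 := by nlinarith
    have hpow : (ℓ ^ 2024)⁻¹ = (ℓ ^ 2022)⁻¹ * (ℓ ^ 2)⁻¹ := by
      rw [← mul_inv, ← pow_add]
    rw [hpow]
    have h3 : 0 < (ℓ ^ 2022)⁻¹ := by positivity
    have h4 : (1 + ℓ) * ℓ * (ℓ ^ 2)⁻¹ ≤ 2 := by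
      rw [mul_inv_le_iff₀ (by positivity)]; linarith
    calc 2 * Real.exp (9 / 2) * (1 + ℓ) * ℓ * ((ℓ ^ 2022)⁻¹ * (ℓ ^ 2)⁻¹)
        = 2 * Real.exp (9 / 2) * (ℓ ^ 2022)⁻¹ * ((1 + ℓ) * ℓ * (ℓ ^ 2)⁻¹) := by ring
      _ ≤ 2 * Real.exp (9 / 2) * (ℓ ^ 2022)⁻¹ * 2 := by gcongr
      _ = 4 * Real.exp (9 / 2) * (ℓ ^ 2022)⁻¹ := by ring
  calc ‖χ.LFunction (1 + s)‖ ≤ ‖χ.LFunction 1‖ + ‖χ.LFunction (1 + s) - χ.LFunction 1‖ := by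
        have := norm_add_le (χ.LFunction 1) (χ.LFunction (1 + s) - χ.LFunction 1)
        rwa [add_sub_cancel] at this
    _ ≤ (ℓ ^ 2022)⁻¹ + 4 * Real.exp (9 / 2) * (ℓ ^ 2022)⁻¹ := add_le_add hA'.le (hmv.trans h1)
    _ = (1 + 4 * Real.exp (9 / 2)) * (ℓ ^ 2022)⁻¹ := by ring

/-- `Step3u008` — `_holds` alias of `step3u008_holds` above under the fact's exact name (appended
2026-08-28, D-0026 bookkeeping: the proof term is the existing theorem of this file; no statement,
definition or attribute is edited; no new named fact; the ledger's debt table listed the fact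
unproved). [cite: Zhang2022LandauSiegel, §3 p.13] -/
theorem _root_.Literature.NumberTheory.LFunctions.Zhang2022.Section3.Step3u008_holds : Step3u008 :=
  _root_.Literature.NumberTheory.LFunctions.Zhang2022.Section3.step3u008_holds

/-- `Z22:§3.u009` [Z22 p.13, tex L750] «and `ζ(1+s) ≪ 𝓛²⁰²⁴`, `(P^{2s} − D^{4s})Γ(s) ≪ 𝓛⁹`»
(for `|s| = α*`). CLAIM. [cite: Zhang2022LandauSiegel, §3 p.13] -/
def Step3u009 : Prop :=
  ∃ C : ℝ, Skeleton.ForAllLarge fun D _ χ => Skeleton.AssumptionA D χ →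
    ∀ s : ℂ, ‖s‖ = alphaStar D →
      ‖riemannZeta (1 + s)‖ ≤ C * Skeleton.ell D ^ 2024 ∧
      ‖(((Skeleton.bigP D : ℝ) : ℂ) ^ (2 * s) - ((D : ℝ) : ℂ) ^ (4 * s)) * Complex.Gamma s‖ ≤
        C * Skeleton.ell D ^ 9

/-- `Z22:Lem3.1.pf` [Z22 pp.12–13, tex L717–753]: the manuscript's proof of Lemma 3.1 as a
deduction node — smoothing and Mellin (`u006`), contour shift to the residue circle (`u007`), and the
three bounds on `|s| = α*` (`u008`, `u009`, (3.3) for `φ(1+s) = O(1)`) «It follows that the residue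
at `s = 0` is `≪ 𝓛⁻²⁰¹¹`, whence the result follows.» DISCHARGED below (`ded31_holds`), since the
conclusion `Skeleton.Lemma31` is itself a theorem of the tree. [cite: Zhang2022LandauSiegel, §3 pp.12–13] -/
def Ded31 : Prop :=
  Step3u006a → Step3u006b → Step3u007 → Step3u008 → Step3u009 → Eq33 → Skeleton.Lemma31

/-- `Ded31` holds — its conclusion is the tree theorem `Skeleton.lemma31_holds`
(`Lemma31.lemma_3_1_complex`, which runs this very contour argument in the kernel).
[cite: Zhang2022LandauSiegel, §3 Lemma 3.1] -/
theorem ded31_holds : Ded31 := fun _ _ _ _ _ _ => Skeleton.lemma31_holds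

/-- `Ded31` — `_holds` alias of `ded31_holds` above under the fact's exact name (appended
2026-08-28, D-0026 bookkeeping: the proof term is the existing theorem of this file; no statement,
definition or attribute is edited; no new named fact; the ledger's debt table listed the fact
unproved). [cite: Zhang2022LandauSiegel, §3 Lemma 3.1] -/
theorem _root_.Literature.NumberTheory.LFunctions.Zhang2022.Section3.Ded31_holds : Ded31 :=
  _root_.Literature.NumberTheory.LFunctions.Zhang2022.Section3.ded31_holds

end LemmaThreeOne

/-! ## §3 pp. 13–14: the sketch of Lemma 3.2 — `φ*` -/

section LemmaThreeTwo

variable {D : ℕ} [NeZero D] (χ : DirichletCharacter ℂ D)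

/-- `Z22:§3.u011` [Z22 p.13, tex L765] «the function `φ*(s) = ζ(s)⁻⁸L(s,χ)⁻⁸Σ_n ν(n)²τ₂(n)²n⁻ˢ`»
— the printed definition (`σ > 1`); its continuation is the tree's Euler product `PhiStar.phiStar χ`
(`phiStarSeries_eq_phiStar`). [cite: Zhang2022LandauSiegel, §3 p.13] -/
def phiStarSeries (s : ℂ) : ℂ :=
  (riemannZeta s ^ 8)⁻¹ * (χ.LFunction s ^ 8)⁻¹ *
    L (fun n => Skeleton.nu χ n ^ 2 * (n.divisors.card : ℂ) ^ 2) s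

/-- **`φ*` as an Euler product**: for `χ² = 1` and `σ > 1`, `φ*(s) = PhiStar.phiStar χ s` (tree
`PhiStar.LSeries_nu_sq_tau_sq_eq`). [cite: Zhang2022LandauSiegel, §3 p.13] -/
theorem phiStarSeries_eq_phiStar (hχ : χ ^ 2 = 1) {s : ℂ} (hs : 1 < s.re) :
    phiStarSeries χ s = PhiStar.phiStar χ s := by
  have hζ : riemannZeta s ≠ 0 := riemannZeta_ne_zero_of_one_lt_re hs
  have hs1 : s ≠ 1 := fun h => by simp [h] at hs
  have hL : χ.LFunction s ≠ 0 :=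
    DirichletCharacter.LFunction_ne_zero_of_one_le_re χ (Or.inr hs1) hs.le
  have key := PhiStar.LSeries_nu_sq_tau_sq_eq χ hχ hs
  rw [← DirichletCharacter.LFunction_eq_LSeries χ hs] at key
  unfold phiStarSeries Skeleton.nu
  rw [key]
  field_simp

/-- [Z22 p.14, tex L768] «is analytic for `σ > 1/2`» — PROVED for the continuation
`PhiStar.phiStar χ` (tree `PhiStar.differentiableOn_phiStar`). [cite: Zhang2022LandauSiegel, §3 p.14] -/
theorem phiStar_differentiableOn (hχ : χ ^ 2 = 1) :
    DifferentiableOn ℂ (PhiStar.phiStar χ) {s : ℂ | 1 / 2 < s.re} :=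
  PhiStar.differentiableOn_phiStar χ hχ

/-- `Z22:§3.u012` [Z22 p.14, tex L769] «and it satisfies `φ*(s) ≪ ∏_{p∣D}|1 − p^{−4s}|` for
`σ ≥ σ₁ > 1/2`, the implies [sic] constant depending on `σ₁`» (on the continuation
`PhiStar.phiStar χ`, `χ` real primitive mod `D`). CLAIM (the tree's `PhiStar.norm_phiStar_le` has a
different majorant, `64^{ω(D)}·exp(c Σ_p p^{−2σ₀})`). [cite: Zhang2022LandauSiegel, §3 p.14] -/
def Step3u012 : Prop :=
  ∀ σ₁ : ℝ, 1 / 2 < σ₁ → ∃ C : ℝ, ∀ (D : ℕ) [NeZero D] (χ : DirichletCharacter ℂ D),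
    χ.IsQuadratic → χ.IsPrimitive → ∀ s : ℂ, σ₁ ≤ s.re →
      ‖PhiStar.phiStar χ s‖ ≤ C * ∏ p ∈ D.primeFactors, ‖1 - (p : ℂ) ^ (-4 * s)‖

/-- The integrand of `Z22:§3.u013`: `φ*(1+s)ζ(1+s)⁸L(1+s,χ)⁸(D^{8s} − D^{4s})Γ(s)`.
[cite: Zhang2022LandauSiegel, §3 p.14] -/
def integrand32 (s : ℂ) : ℂ :=
  PhiStar.phiStar χ (1 + s) * riemannZeta (1 + s) ^ 8 * χ.LFunction (1 + s) ^ 8 *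
    (((D : ℝ) : ℂ) ^ (8 * s) - ((D : ℝ) : ℂ) ^ (4 * s)) * Complex.Gamma s

/-- `Z22:§3.u013` [Z22 p.14, tex L773] «Also, one can verify that
`∫_{|s|=α*} φ*(1+s)ζ(1+s)⁸L(1+s,χ)⁸(D^{8s} − D^{4s})Γ(s) ds ≪ 𝓛⁻²⁰⁰⁷`» (under (A), as Lemma 3.2).
CLAIM. [cite: Zhang2022LandauSiegel, §3 p.14] -/
def Step3u013 : Prop :=
  ∃ C : ℝ, Skeleton.ForAllLarge fun D _ χ => Skeleton.AssumptionA D χ →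
    ‖∮ z in C(0, alphaStar D), integrand32 χ z‖ ≤ C * (Skeleton.ell D ^ 2007)⁻¹

/-- `Z22:Lem3.2.pf` [Z22 pp.13–14, tex L763–776] «As the situation is analogous to Lemma 3.1 we give
a sketch only»: the deduction of `Skeleton.Lemma32` from the `φ*` bound (`u012`) and the circle
integral estimate (`u013`) via the same smoothing/Mellin/contour route as Lemma 3.1. CLAIM (typed as
the implication; the smoothing/shift steps for the eighth powers are not displayed in print).
[cite: Zhang2022LandauSiegel, §3 pp.13–14] -/
def Ded32 : Prop := Step3u012 → Step3u013 → Skeleton.Lemma32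

end LemmaThreeTwo

/-! ## §3 pp. 14–16: `F²⁰`, `G²⁰`, the second moments, and the deductions of Lemmas 3.4–3.6 -/

section Moments

/-- `τ_k(n)`, the `k`-fold divisor function (number of ordered factorisations of `n` into `k`
factors) = the `k`-th Dirichlet-convolution power of the constant function `1`
(`ArithmeticFunction.zeta ^ k`); `τ₂(n) = #divisors(n)`. [folklore] -/
def tauK (k n : ℕ) : ℕ := (ArithmeticFunction.zeta ^ k : ArithmeticFunction ℕ) n

variable {D : ℕ} [NeZero D] (χ : DirichletCharacter ℂ D)

/-- `Z22:§3.u017` [Z22 p.15, tex L801–804] «By (3.1) we may write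
`F(s,ψ)²⁰ = Σ_{n≤D⁸⁰} ν₂₀(n)ψ(n)n⁻ˢ`, `G(s,ψ)²⁰ = Σ_{n≤D⁸⁰} υ₂₀(n)ψ(n)n⁻ˢ` with `|ν₂₀(n)| ≤ τ₄₀(n)`,
`|υ₂₀(n)| ≤ τ₄₀(n)`» (print: «|\nu_{20}{n}|»). `F, G, ν₂₀, υ₂₀` = `Skeleton.Fpoly/Gpoly/nu20/ups20`.
Unconditional. CLAIM. [cite: Zhang2022LandauSiegel, §3 p.15] -/
def Step3u017 : Prop :=
  ∀ (D : ℕ) [NeZero D] (χ : DirichletCharacter ℂ D) (x : Skeleton.Chr D) (s : ℂ),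
    χ.IsQuadratic →
    Skeleton.Fpoly χ x s ^ 20 =
      ∑ n ∈ Finset.Icc 1 (D ^ 80), Skeleton.nu20 χ n * x.ψ (n : ZMod x.p) * (n : ℂ) ^ (-s) ∧
    Skeleton.Gpoly χ x s ^ 20 =
      ∑ n ∈ Finset.Icc 1 (D ^ 80), Skeleton.ups20 χ n * x.ψ (n : ZMod x.p) * (n : ℂ) ^ (-s) ∧
    (∀ n : ℕ, ‖Skeleton.nu20 χ n‖ ≤ tauK 40 n ∧ ‖Skeleton.ups20 χ n‖ ≤ tauK 40 n)

variable (x : Skeleton.Chr D)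

/-- The left side of (3.4): `|X₁(D⁸⁰,ψ)| + |X₂(D⁸⁰,ψ)| + ∫₁^{D⁸⁰}(|X₁(x,ψ)| + |X₂(x,ψ)|)dx/x`
(the quantity whose second moment `Z22:§3.u019` bounds; `Skeleton.Ineq34 ↔ lhs34 < 𝓛¹¹⁷¹`,
`ineq34_iff`). [cite: Zhang2022LandauSiegel, §3 (3.4) p.15] -/
def lhs34 : ℝ :=
  ‖Skeleton.X1 χ x ((D : ℝ) ^ 80)‖ + ‖Skeleton.X2 χ x ((D : ℝ) ^ 80)‖
    + ∫ y in (1 : ℝ)..(D : ℝ) ^ 80, (‖Skeleton.X1 χ x y‖ + ‖Skeleton.X2 χ x y‖) / y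

omit [NeZero D] in
/-- Bridge: the banked (3.4) is `lhs34 < 𝓛¹¹⁷¹`, definitionally. [cite: Zhang2022LandauSiegel, §3 (3.4) p.15] -/
theorem ineq34_iff : Skeleton.Ineq34 χ x ↔ lhs34 χ x < Skeleton.ell D ^ 1171 := Iff.rfl

/-- The left side of (3.5): `|X₃(P²,ψ)| + ∫_{D⁴}^{P²}|X₃(x,ψ)|dx/x` (`Skeleton.Ineq35 ↔ lhs35 < 𝓛⁻⁵⁸⁵`).
[cite: Zhang2022LandauSiegel, §3 (3.5) p.15] -/
def lhs35 : ℝ :=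
  ‖Skeleton.X3 χ x (Skeleton.bigP D ^ 2)‖
    + ∫ y in (D : ℝ) ^ 4..Skeleton.bigP D ^ 2, ‖Skeleton.X3 χ x y‖ / y

omit [NeZero D] in
/-- Bridge: the banked (3.5) is `lhs35 < 𝓛⁻⁵⁸⁵`, definitionally. [cite: Zhang2022LandauSiegel, §3 (3.5) p.15] -/
theorem ineq35_iff : Skeleton.Ineq35 χ x ↔ lhs35 χ x < (Skeleton.ell D ^ 585)⁻¹ := Iff.rfl

/-- The left side of (3.6): `|X₄(D⁸,ψ)| + ∫_{D⁴}^{D⁸}|X₄(x,ψ)|dx/x` (`Skeleton.Ineq36 ↔ lhs36 < 𝓛⁻⁶³³`).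
[cite: Zhang2022LandauSiegel, §3 (3.6) p.16] -/
def lhs36 : ℝ :=
  ‖Skeleton.X4 χ x ((D : ℝ) ^ 8)‖
    + ∫ y in (D : ℝ) ^ 4..(D : ℝ) ^ 8, ‖Skeleton.X4 χ x y‖ / y

omit [NeZero D] in
/-- Bridge: the banked (3.6) is `lhs36 < 𝓛⁻⁶³³`, definitionally. [cite: Zhang2022LandauSiegel, §3 (3.6) p.16] -/
theorem ineq36_iff : Skeleton.Ineq36 χ x ↔ lhs36 χ x < (Skeleton.ell D ^ 633)⁻¹ := Iff.rfl

/-- `Z22:§3.u019` [Z22 p.15, tex L811] «By Cauchy's inequality and the first assertion of Lemma 3.3 we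
obtain `Σ_{ψ∈Ψ}(|X₁(D⁸⁰,ψ)| + |X₂(D⁸⁰,ψ)| + ∫₁^{D⁸⁰}(|X₁| + |X₂|)dx/x)² ≪ 𝔓𝓛¹⁶⁰²`.» Unconditional
(no (A) before tex L828). CLAIM. [cite: Zhang2022LandauSiegel, §3 p.15] -/
def Step3u019 : Prop :=
  ∃ C : ℝ, Skeleton.ForAllLarge fun D _ χ =>
    ∑ᶠ x : Skeleton.Chr D, lhs34 χ x ^ 2 ≤ C * frakP D * Skeleton.ell D ^ 1602

/-- `Z22:Lem3.4` as a DEDUCTION node [Z22 p.15, tex L814 «Thus we conclude» Lemma 3.4]: the counting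
step from the second moment `u019` to "(3.4) fails for at most `O(𝔓𝓛⁻⁷⁴⁰)` characters"
(`1602 − 2·1171 = −740`, tree `Zhang2022.lemma34_exponent`, `exceptional_card_le`). CLAIM (edge to be
proved in the §3 edges file). [cite: Zhang2022LandauSiegel, §3 Lemma 3.4 p.15] -/
def Ded34 : Prop := Step3u019 → Skeleton.Lemma34

/-- `Z22:§3.u021`, first `≪` [Z22 p.15, tex L829] «Assume that (A) holds. By Cauchy's inequality, the
second assertion of Lemma 3.2 [print slip: Lemma 3.3] and Lemma 3.1,
`Σ_{ψ∈Ψ}(|X₃(P²,ψ)| + ∫_{D⁴}^{P²}|X₃(x,ψ)|dx/x)² ≪ P²𝓛⁻¹⁹⁹³`.» CLAIM.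
[cite: Zhang2022LandauSiegel, §3 p.15] -/
def Step3u021a : Prop :=
  ∃ C : ℝ, Skeleton.ForAllLarge fun D _ χ => Skeleton.AssumptionA D χ →
    ∑ᶠ x : Skeleton.Chr D, lhs35 χ x ^ 2 ≤ C * Skeleton.bigP D ^ 2 * (Skeleton.ell D ^ 1993)⁻¹

omit [NeZero D] in
/-- `Z22:§3.u021`, second `≪` [Z22 p.15, tex L829]: «`P²𝓛⁻¹⁹⁹³ ≪ 𝔓𝓛⁻¹⁹⁰⁹`» — a parameter fact
(`𝔓 = (1+o(1))P²𝓛⁻⁷⁷` (2.9), and `−1993 + 77 = −1916 ≤ −1909`, tree `lemma35_moment_exponent`,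
`frakP_bounds`). CLAIM. [cite: Zhang2022LandauSiegel, §3 p.15] -/
def Step3u021b : Prop :=
  ∃ C : ℝ, ∃ D₀ : ℕ, ∀ D : ℕ, D₀ ≤ D →
    Skeleton.bigP D ^ 2 * (Skeleton.ell D ^ 1993)⁻¹ ≤ C * frakP D * (Skeleton.ell D ^ 1909)⁻¹

/-- `Z22:Lem3.5` as a DEDUCTION node [Z22 p.15, tex L832 «Thus we conclude» Lemma 3.5]: counting from
`u021` (`−1909 + 2·585 = −739`, tree `lemma35_exponent`). CLAIM (edge for the §3 edges file).
[cite: Zhang2022LandauSiegel, §3 Lemma 3.5 p.15] -/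
def Ded35 : Prop := Step3u021a → Step3u021b → Skeleton.Lemma35

/-- [Z22 p.15, tex L846] «We have `ς(n) = 0` unless `n = 1` or `D⁴ < n ≤ D⁸`» (`ς = Skeleton.sig χ`,
the truncated convolution `Σ_{n=lm, l,m≤D⁴}ν(l)υ(m)`; for `1 < n ≤ D⁴` it is the full `(ν ∗ υ)(n) = 0`).
CLAIM. [cite: Zhang2022LandauSiegel, §3 p.15] -/
def SigSupport : Prop :=
  ∀ (D : ℕ) [NeZero D] (χ : DirichletCharacter ℂ D) (n : ℕ), χ.IsQuadratic →
    Skeleton.sig χ n ≠ 0 → n = 1 ∨ (D ^ 4 < n ∧ n ≤ D ^ 8)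

/-- `Z22:§3.u024` [Z22 p.16, tex L851] «It is direct to verify that
`|ς(n)| ≤ Σ_{n=lm} ν(l)|υ(m)| ≤ ν(n)τ₂(n)`» (tree, real-AF vocabulary:
`SigmaMajorant.abs_sigmaTrunc_le_card_mul_nuOf`). Unconditional. CLAIM.
[cite: Zhang2022LandauSiegel, §3 p.16] -/
def Step3u024 : Prop :=
  ∀ (D : ℕ) [NeZero D] (χ : DirichletCharacter ℂ D) (n : ℕ), χ.IsQuadratic →
    ‖Skeleton.sig χ n‖ ≤
        ∑ lm ∈ n.divisorsAntidiagonal, (Skeleton.nu χ lm.1).re * ‖Skeleton.ups χ lm.2‖ ∧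
      ∑ lm ∈ n.divisorsAntidiagonal, (Skeleton.nu χ lm.1).re * ‖Skeleton.ups χ lm.2‖ ≤
        (Skeleton.nu χ n).re * (n.divisors.card : ℝ)

/-- `Z22:§3.u025` [Z22 p.16, tex L855] «Assume that (A) holds. By Cauchy's inequality, the first
assertion of Lemma 3.2 [print slip: Lemma 3.3] and Lemma 3.1,
`Σ_{ψ∈Ψ}(|X₄(D⁸,ψ)| + ∫_{D⁴}^{D⁸}|X₄(x,ψ)|dx/x)² ≪ 𝔓𝓛⁻²⁰⁰⁵`.» CLAIM.
[cite: Zhang2022LandauSiegel, §3 p.16] -/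
def Step3u025 : Prop :=
  ∃ C : ℝ, Skeleton.ForAllLarge fun D _ χ => Skeleton.AssumptionA D χ →
    ∑ᶠ x : Skeleton.Chr D, lhs36 χ x ^ 2 ≤ C * frakP D * (Skeleton.ell D ^ 2005)⁻¹

/-- `Z22:Lem3.6` as a DEDUCTION node [Z22 p.16, tex L858 «Thus we conclude» Lemma 3.6]: counting from
`u025` (`−2005 + 2·633 = −739`, tree `lemma36_exponent`). CLAIM (edge for the §3 edges file).
[cite: Zhang2022LandauSiegel, §3 Lemma 3.6 p.16] -/
def Ded36 : Prop := Step3u025 → Skeleton.Lemma36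

end Moments

end Literature.NumberTheory.LFunctions.Zhang2022.Section3
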